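import Literature.MathematicalPhysics.QuantumManyBody.SlidingLemma
import HarnessLib

/-!
# The sliding lemma for jellium (Lieb–Solovej 2001, Lemma 3.1), given the CLY positivity

Topic `Literature/MathematicalPhysics/QuantumManyBody` (groundwork for the charged Bose gas,
`JelliumBoseGas.foldyLaw`; continuation of `SlidingLemma.lean`). [LiebSolovej2001, Lemma 3.1]
("Electrostatic decoupling of boxes using sliding") bounds the FULL jellium energy — particle–
particle, particle–background and background–background — from below by the average over the
position of the localizing cube of the localized energies, minus `ω(t)N/(2ℓ)`. As in
`SlidingLemma.lean` we take the analytic input [ConlonLiebYau1988, Lemma 2.1] as the hypothesis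
`|z|⁻¹ = F(z) + h(z)Y(z)` (`z ≠ 0`), `F = ∫ Φ cos(2π⟨·, z⟩)`, `Φ ≥ 0` integrable,
`h = (∫χ²)⁻¹ H`, `H(z) = ∫ χ(u)χ(u - z) du`, work at scale `ℓ = 1` with the continuous sliding
average `(∫χ²)⁻¹ ∫ dz` (= `γ ∑_λ ∫_μ` of the source, `Coulomb.integral_eq_tsum_integral_unitCube`),
unit charges and a background density `g ∈ L¹` (`= ρ𝟙_Ω`), and prove: with
`w_z(x, y) = χ(x - z) Y(x - y) χ(y - z)` and
`U_z = ∑_{i<j} w_z(xᵢ, xⱼ) - ∑ᵢ ∫ g(y) w_z(xᵢ, y) dy + ½ ∬ g(x)g(y) w_z(x, y)`,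

**`(∫χ²)⁻¹ ∫ U_z dz - ½ (∫Φ) N ≤ ∑_{i<j} |xᵢ - xⱼ|⁻¹ - ∑ᵢ ∫ g(y)|xᵢ - y|⁻¹ dy + ½∬ g(x)g(y)|x - y|⁻¹`.**

Ingredients: `Coulomb.positiveType_points_ge` (the `F`-energy of unit charges and background is
`≥ -½F(0)N`), the sliding identity `∫ χ(x - z)χ(y - z) dz = H(x - y)`
(`Coulomb.integral_mul_sub_sub`) inside the `y`- and `(x, y)`-integrals (Fubini), and the termwise
splitting `|·|⁻¹ = F + hY` off the (null) diagonal.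

* `Coulomb.measurable_cosKernel`, `norm_cosKernel_le`, `measurable_autocorr`, `norm_autocorr_le` —
  `F` and `H` are bounded measurable kernels.
* `Coulomb.sliding_pb_identity`, `sliding_bb_identity` — the sliding identity inside the
  particle–background and background–background integrals.
* `Coulomb.sliding_lemma_jellium` — **the displayed bound**.

## References

* [LiebSolovej2001] E. H. Lieb, J. P. Solovej, Commun. Math. Phys. 217 (2001) 127–163, Lemma 3.1
  and its proof (arXiv:cond-mat/0007425, p. 8).
* [ConlonLiebYau1988] J. G. Conlon, E. H. Lieb, H.-T. Yau, Commun. Math. Phys. 116 (1988) 417–448,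
  Lemma 2.1.
* [LSSY2005] Thm. 10.5 (arXiv Thm. 12.4) and the remark after it (one-component version).
-/

noncomputable section

open MeasureTheory Set Filter Real
open scoped ENNReal NNReal Topology InnerProductSpace

namespace Literature.MathematicalPhysics.QuantumManyBody.Coulomb

open BoseGas

/-! ### Bounded measurable kernels: `F = ∫ Φ cos` and `H = χ ∗ χ(-·)` -/

/-- `z ↦ ∫ Φ(p) cos(2π⟨p, z⟩) dp` is measurable. [folklore] -/
theorem measurable_cosKernel (Φ : Space → ℝ) (hΦm : Measurable Φ) :
    Measurable fun z : Space => ∫ p, Φ p * Real.cos (2 * π * ⟪p, z⟫_ℝ) := by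
  have h : StronglyMeasurable fun q : Space × Space => Φ q.2 * Real.cos (2 * π * ⟪q.2, q.1⟫_ℝ) :=
    ((hΦm.comp measurable_snd).mul (Real.continuous_cos.measurable.comp
      ((continuous_const.mul (continuous_inner.comp
        (continuous_snd.prodMk continuous_fst))).measurable))).stronglyMeasurable
  exact (h.integral_prod_right' (ν := (volume : Measure Space))).measurable

/-- `|∫ Φ(p) cos(2π⟨p, z⟩) dp| ≤ ∫ |Φ|` for integrable `Φ`. [folklore] -/
theorem norm_cosKernel_le {Φ : Space → ℝ} (hΦi : Integrable Φ) (z : Space) :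
    ‖∫ p, Φ p * Real.cos (2 * π * ⟪p, z⟫_ℝ)‖ ≤ ∫ p, ‖Φ p‖ := by
  refine (norm_integral_le_integral_norm _).trans (integral_mono_of_nonneg
    (Eventually.of_forall fun p => norm_nonneg _) hΦi.norm (Eventually.of_forall fun p => ?_))
  dsimp only
  rw [norm_mul]
  calc ‖Φ p‖ * ‖Real.cos (2 * π * ⟪p, z⟫_ℝ)‖ ≤ ‖Φ p‖ * 1 :=
        mul_le_mul_of_nonneg_left (by rw [Real.norm_eq_abs]; exact Real.abs_cos_le_one _) (norm_nonneg _)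
    _ = ‖Φ p‖ := mul_one _

/-- The autocorrelation `z ↦ ∫ χ(u) χ(u - z) du` of a continuous function is measurable. [folklore] -/
theorem measurable_autocorr (χ : Space → ℝ) (hχ : Continuous χ) :
    Measurable fun z : Space => ∫ u, χ u * χ (u - z) := by
  have h : StronglyMeasurable fun q : Space × Space => χ q.2 * χ (q.2 - q.1) :=
    ((hχ.comp continuous_snd).mul (hχ.comp (continuous_snd.sub continuous_fst))).stronglyMeasurable
  exact (h.integral_prod_right' (ν := (volume : Measure Space))).measurable

/-- `|∫ χ(u) χ(u - z) du| ≤ M ∫ |χ|` if `|χ| ≤ M`. [folklore] -/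
theorem norm_autocorr_le {χ : Space → ℝ} (hχint : Integrable χ) {M : ℝ} (hM : ∀ u, ‖χ u‖ ≤ M)
    (z : Space) : ‖∫ u, χ u * χ (u - z)‖ ≤ M * ∫ u, ‖χ u‖ := by
  have hM0 : 0 ≤ M := (norm_nonneg _).trans (hM 0)
  refine (norm_integral_le_integral_norm _).trans ?_
  rw [← integral_const_mul]
  refine integral_mono_of_nonneg (Eventually.of_forall fun u => norm_nonneg _)
    (hχint.norm.const_mul M) (Eventually.of_forall fun u => ?_)
  dsimp only
  rw [norm_mul, mul_comm M]
  exact mul_le_mul_of_nonneg_left (hM _) (norm_nonneg _)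

/-! ### The sliding identity inside the background integrals -/

/-- **Sliding identity in the particle–background term**: for continuous compactly supported
`χ`, measurable `Y`, `g` with `y ↦ g(y)Y(a - y)` integrable,
`∫ (∫ g(y) χ(a - z) Y(a - y) χ(y - z) dy) dz = ∫ g(y) (H(a - y) Y(a - y)) dy`,
`H(w) = ∫ χ(u)χ(u - w) du`, and the `z`-integrand is integrable (Fubini on
`|g(y)Y(a - y)| · |χ(a - z)χ(y - z)|`). [cite: LiebSolovej2001, Lemma 3.1 (proof)] -/
theorem sliding_pb_identity {χ : Space → ℝ} (hχ : Continuous χ) (hsupp : HasCompactSupport χ)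
    {Y : Space → ℝ} (hYm : Measurable Y) {g : Space → ℝ} (hgm : Measurable g) (a : Space)
    (hgY : Integrable fun y : Space => g y * Y (a - y)) :
    Integrable (fun z : Space => ∫ y, g y * (χ (a - z) * Y (a - y) * χ (y - z))) ∧
      ∫ z : Space, ∫ y, g y * (χ (a - z) * Y (a - y) * χ (y - z)) =
        ∫ y, g y * ((∫ u, χ u * χ (u - (a - y))) * Y (a - y)) := by
  obtain ⟨M, hMr⟩ := (hχ.norm.bddAbove_range_of_hasCompactSupport hsupp.norm)
  have hM : ∀ u, ‖χ u‖ ≤ M := fun u => hMr ⟨u, rfl⟩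
  have hM0 : 0 ≤ M := (norm_nonneg _).trans (hM 0)
  have hχint : Integrable χ := hχ.integrable_of_hasCompactSupport hsupp
  -- the integrand on `(y, z)`
  set P : Space × Space → ℝ := fun q => g q.1 * Y (a - q.1) * (χ (a - q.2) * χ (q.1 - q.2)) with hP
  have hPm : Measurable P :=
    ((hgm.comp measurable_fst).mul (hYm.comp (measurable_const.sub measurable_fst))).mul
      ((hχ.measurable.comp (measurable_const.sub measurable_snd)).mul
        (hχ.measurable.comp (measurable_fst.sub measurable_snd)))
  have hzint : ∀ y : Space, Integrable fun z : Space => χ (a - z) * χ (y - z) := fun y => by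
    have h := integrable_sub_mul χ hχ hsupp 1 a y
    simpa using h
  have hzbound : ∀ y : Space, ∫ z : Space, ‖χ (a - z) * χ (y - z)‖ ≤ M * ∫ u, ‖χ u‖ := by
    intro y
    have h1 : ∫ z : Space, ‖χ (a - z) * χ (y - z)‖ ≤ ∫ z : Space, ‖χ (a - z)‖ * M := by
      refine integral_mono_of_nonneg (Eventually.of_forall fun z => norm_nonneg _)
        ((hχint.comp_sub_left a).norm.mul_const M) (Eventually.of_forall fun z => ?_)
      dsimp only
      rw [norm_mul]
      exact mul_le_mul_of_nonneg_left (hM _) (norm_nonneg _)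
    rw [integral_mul_const, integral_sub_left_eq_self (fun u => ‖χ u‖) volume a] at h1
    linarith
  have hPi : Integrable P (volume.prod volume) := by
    rw [integrable_prod_iff hPm.aestronglyMeasurable]
    constructor
    · exact Eventually.of_forall fun y => by
        simpa [hP, mul_assoc] using (hzint y).const_mul (g y * Y (a - y))
    · have hae : AEStronglyMeasurable (fun y => ∫ z, ‖P (y, z)‖) volume :=
        hPm.norm.aestronglyMeasurable.integral_prod_right'
      refine (hgY.norm.mul_const (M * ∫ u, ‖χ u‖)).mono' hae (Eventually.of_forall fun y => ?_)
      rw [Real.norm_of_nonneg (integral_nonneg fun z => norm_nonneg _)]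
      have e : ∀ z, ‖P (y, z)‖ = ‖g y * Y (a - y)‖ * ‖χ (a - z) * χ (y - z)‖ := by
        intro z
        simp only [hP, norm_mul]
      simp_rw [e]
      rw [integral_const_mul]
      exact mul_le_mul_of_nonneg_left (hzbound y) (norm_nonneg _)
  have hPint_left : Integrable (fun z : Space => ∫ y, P (y, z)) := hPi.integral_prod_right
  have e1 : ∀ z y, g y * (χ (a - z) * Y (a - y) * χ (y - z)) = P (y, z) := by
    intro z y
    simp only [hP]
    ring
  refine ⟨hPint_left.congr (Eventually.of_forall fun z => ?_), ?_⟩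
  · exact integral_congr_ae (Eventually.of_forall fun y => (e1 z y).symm)
  · have e2 : ∫ z : Space, ∫ y, g y * (χ (a - z) * Y (a - y) * χ (y - z)) = ∫ z : Space, ∫ y, P (y, z) := by
      refine integral_congr_ae (Eventually.of_forall fun z => ?_)
      exact integral_congr_ae (Eventually.of_forall fun y => e1 z y)
    rw [e2, ← integral_integral_swap hPi]
    refine integral_congr_ae (Eventually.of_forall fun y => ?_)
    show ∫ z, P (y, z) = g y * ((∫ u, χ u * χ (u - (a - y))) * Y (a - y))
    simp only [hP]
    rw [integral_const_mul, integral_mul_sub_sub χ χ a y]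
    ring

/-- **Sliding identity in the background–background term**: for continuous compactly supported
`χ`, measurable `Y`, `g` with `(x, y) ↦ g(x)g(y)Y(x - y)` integrable on `ℝ³ × ℝ³`,
`∫ (∬ g(x)g(y) χ(x - z)Y(x - y)χ(y - z)) dz = ∬ g(x)g(y) (H(x - y) Y(x - y))`, and the `z`-integrand
is integrable. [cite: LiebSolovej2001, Lemma 3.1 (proof)] -/
theorem sliding_bb_identity {χ : Space → ℝ} (hχ : Continuous χ) (hsupp : HasCompactSupport χ)
    {Y : Space → ℝ} (hYm : Measurable Y) {g : Space → ℝ} (hgm : Measurable g)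
    (hggY : Integrable (fun q : Space × Space => g q.1 * g q.2 * Y (q.1 - q.2)) (volume.prod volume)) :
    Integrable (fun z : Space => ∫ q : Space × Space,
        g q.1 * g q.2 * (χ (q.1 - z) * Y (q.1 - q.2) * χ (q.2 - z)) ∂(volume.prod volume)) ∧
      ∫ z : Space, ∫ q : Space × Space, g q.1 * g q.2 * (χ (q.1 - z) * Y (q.1 - q.2) * χ (q.2 - z))
          ∂(volume.prod volume) =
        ∫ q : Space × Space, g q.1 * g q.2 * ((∫ u, χ u * χ (u - (q.1 - q.2))) * Y (q.1 - q.2))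
          ∂(volume.prod volume) := by
  obtain ⟨M, hMr⟩ := (hχ.norm.bddAbove_range_of_hasCompactSupport hsupp.norm)
  have hM : ∀ u, ‖χ u‖ ≤ M := fun u => hMr ⟨u, rfl⟩
  have hM0 : 0 ≤ M := (norm_nonneg _).trans (hM 0)
  have hχint : Integrable χ := hχ.integrable_of_hasCompactSupport hsupp
  set Q : (Space × Space) × Space → ℝ := fun r =>
    g r.1.1 * g r.1.2 * Y (r.1.1 - r.1.2) * (χ (r.1.1 - r.2) * χ (r.1.2 - r.2)) with hQ
  have hQm : Measurable Q :=
    (((hgm.comp (measurable_fst.comp measurable_fst)).mul (hgm.comp (measurable_snd.comp measurable_fst))).mul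
      (hYm.comp ((measurable_fst.comp measurable_fst).sub (measurable_snd.comp measurable_fst)))).mul
      ((hχ.measurable.comp ((measurable_fst.comp measurable_fst).sub measurable_snd)).mul
        (hχ.measurable.comp ((measurable_snd.comp measurable_fst).sub measurable_snd)))
  have hzint : ∀ q : Space × Space, Integrable fun z : Space => χ (q.1 - z) * χ (q.2 - z) := fun q => by
    have h := integrable_sub_mul χ hχ hsupp 1 q.1 q.2
    simpa using h
  have hzbound : ∀ q : Space × Space, ∫ z : Space, ‖χ (q.1 - z) * χ (q.2 - z)‖ ≤ M * ∫ u, ‖χ u‖ := by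
    intro q
    have h1 : ∫ z : Space, ‖χ (q.1 - z) * χ (q.2 - z)‖ ≤ ∫ z : Space, ‖χ (q.1 - z)‖ * M := by
      refine integral_mono_of_nonneg (Eventually.of_forall fun z => norm_nonneg _)
        ((hχint.comp_sub_left q.1).norm.mul_const M) (Eventually.of_forall fun z => ?_)
      dsimp only
      rw [norm_mul]
      exact mul_le_mul_of_nonneg_left (hM _) (norm_nonneg _)
    rw [integral_mul_const, integral_sub_left_eq_self (fun u => ‖χ u‖) volume q.1] at h1
    linarith
  have hQi : Integrable Q ((volume.prod volume).prod volume) := by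
    rw [integrable_prod_iff hQm.aestronglyMeasurable]
    constructor
    · exact Eventually.of_forall fun q => by
        simpa [hQ, mul_assoc] using (hzint q).const_mul (g q.1 * g q.2 * Y (q.1 - q.2))
    · have hae : AEStronglyMeasurable (fun q => ∫ z, ‖Q (q, z)‖) (volume.prod volume) :=
        hQm.norm.aestronglyMeasurable.integral_prod_right'
      refine (hggY.norm.mul_const (M * ∫ u, ‖χ u‖)).mono' hae (Eventually.of_forall fun q => ?_)
      rw [Real.norm_of_nonneg (integral_nonneg fun z => norm_nonneg _)]
      have e : ∀ z, ‖Q (q, z)‖ = ‖g q.1 * g q.2 * Y (q.1 - q.2)‖ * ‖χ (q.1 - z) * χ (q.2 - z)‖ := by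
        intro z
        simp only [hQ, norm_mul]
      simp_rw [e]
      rw [integral_const_mul]
      exact mul_le_mul_of_nonneg_left (hzbound q) (norm_nonneg _)
  have hQint_left : Integrable (fun z : Space => ∫ q, Q (q, z) ∂(volume.prod volume)) :=
    hQi.integral_prod_right
  have e1 : ∀ z (q : Space × Space), g q.1 * g q.2 * (χ (q.1 - z) * Y (q.1 - q.2) * χ (q.2 - z)) = Q (q, z) := by
    intro z q
    simp only [hQ]
    ring
  refine ⟨hQint_left.congr (Eventually.of_forall fun z => ?_), ?_⟩
  · exact integral_congr_ae (Eventually.of_forall fun q => (e1 z q).symm)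
  · have e2 : ∫ z : Space, ∫ q : Space × Space, g q.1 * g q.2 * (χ (q.1 - z) * Y (q.1 - q.2) * χ (q.2 - z))
          ∂(volume.prod volume) = ∫ z : Space, ∫ q, Q (q, z) ∂(volume.prod volume) := by
      refine integral_congr_ae (Eventually.of_forall fun z => ?_)
      exact integral_congr_ae (Eventually.of_forall fun q => e1 z q)
    rw [e2, ← integral_integral_swap hQi]
    refine integral_congr_ae (Eventually.of_forall fun q => ?_)
    show ∫ z, Q (q, z) = g q.1 * g q.2 * ((∫ u, χ u * χ (u - (q.1 - q.2))) * Y (q.1 - q.2))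
    simp only [hQ]
    rw [integral_const_mul, integral_mul_sub_sub χ χ q.1 q.2]
    ring

/-! ### Lemma 3.1, given the CLY positivity -/

/-- **The sliding lemma for jellium** [LiebSolovej2001, Lemma 3.1], conditional on the CLY
positivity: let `χ` be continuous with compact support, `Y` measurable, `Φ ≥ 0` measurable and
integrable with `|z|⁻¹ = ∫ Φ(p)cos(2π⟨p, z⟩)dp + ((∫χ²)⁻¹ ∫χ(u)χ(u - z)du) · Y(z)` for `z ≠ 0`
([ConlonLiebYau1988, Lemma 2.1] for `Y = Y_ω`, `∫Φ = ω`); let `x₁, …, x_N` be distinct and `g` a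
measurable integrable background with finite particle–background and background–background
`Y`-energies. Then, with `w_z(x, y) = χ(x - z)Y(x - y)χ(y - z)`,
`(∫χ²)⁻¹ ∫ [∑_{i<j} w_z(xᵢ,xⱼ) - ∑ᵢ ∫ g(y)w_z(xᵢ,y)dy + ½∬ g g w_z] dz - ½(∫Φ)N
 ≤ ∑_{i<j}|xᵢ - xⱼ|⁻¹ - ∑ᵢ ∫ g(y)|xᵢ - y|⁻¹dy + ½∬ g(x)g(y)|x - y|⁻¹`.
[cite: LiebSolovej2001, Lemma 3.1] -/
theorem sliding_lemma_jellium {χ : Space → ℝ} (hχ : Continuous χ) (hsupp : HasCompactSupport χ)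
    {Y : Space → ℝ} (hYm : Measurable Y) {Φ : Space → ℝ} (hΦm : Measurable Φ) (hΦi : Integrable Φ)
    (hΦ0 : ∀ p, 0 ≤ Φ p)
    (hF : ∀ z : Space, z ≠ 0 → ‖z‖⁻¹ =
      (∫ p, Φ p * Real.cos (2 * π * ⟪p, z⟫_ℝ)) +
        ((∫ u, χ u ^ 2)⁻¹ * ∫ u, χ u * χ (u - z)) * Y z)
    {N : ℕ} {X : Fin N → Space} (hX : Function.Injective X) {g : Space → ℝ} (hgm : Measurable g)
    (hg : Integrable g) (hgY : ∀ i, Integrable fun y : Space => g y * Y (X i - y))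
    (hggY : Integrable (fun q : Space × Space => g q.1 * g q.2 * Y (q.1 - q.2)) (volume.prod volume)) :
    (∫ u, χ u ^ 2)⁻¹ * (∫ z : Space,
          ((∑ i, ∑ j with i < j, χ (X i - z) * Y (X i - X j) * χ (X j - z)) -
            (∑ i, ∫ y, g y * (χ (X i - z) * Y (X i - y) * χ (y - z))) +
            1 / 2 * ∫ q : Space × Space, g q.1 * g q.2 * (χ (q.1 - z) * Y (q.1 - q.2) * χ (q.2 - z))
              ∂(volume.prod volume))) -
        1 / 2 * (∫ p, Φ p) * N ≤
      (∑ i, ∑ j with i < j, ‖X i - X j‖⁻¹) - (∑ i, ∫ y, g y * ‖X i - y‖⁻¹) +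
        1 / 2 * ∫ q : Space × Space, g q.1 * g q.2 * ‖q.1 - q.2‖⁻¹ ∂(volume.prod volume) := by
  obtain ⟨M, hMr⟩ := (hχ.norm.bddAbove_range_of_hasCompactSupport hsupp.norm)
  have hM : ∀ u, ‖χ u‖ ≤ M := fun u => hMr ⟨u, rfl⟩
  have hχint : Integrable χ := hχ.integrable_of_hasCompactSupport hsupp
  -- Step 1: positivity of the `F`-energy with unit charges
  have h0 := positiveType_points_ge hΦm hΦi hΦ0 (fun _ : Fin N => (1 : ℝ)) X hgm hg
  simp only [one_mul, one_pow, Finset.sum_const, Finset.card_univ, Fintype.card_fin, nsmul_eq_mul,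
    mul_one] at h0
  -- Step 2: the sliding identities
  have hslide : ∀ i j : Fin N, ∫ z : Space, χ (X i - z) * Y (X i - X j) * χ (X j - z) =
      (∫ u, χ u * χ (u - (X i - X j))) * Y (X i - X j) := by
    intro i j
    rw [← integral_mul_sub_sub χ χ (X i) (X j), ← integral_mul_const]
    refine integral_congr_ae (Eventually.of_forall fun z => ?_)
    simp only
    ring
  have hppint : ∀ i j : Fin N, Integrable fun z : Space => χ (X i - z) * Y (X i - X j) * χ (X j - z) :=
    fun i j => integrable_sub_mul χ hχ hsupp (Y (X i - X j)) (X i) (X j)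
  have hppI : Integrable fun z : Space => ∑ i, ∑ j with i < j, χ (X i - z) * Y (X i - X j) * χ (X j - z) :=
    integrable_finsetSum _ fun i _ => integrable_finsetSum _ fun j _ => hppint i j
  have hpp : ∫ z : Space, ∑ i, ∑ j with i < j, χ (X i - z) * Y (X i - X j) * χ (X j - z) =
      ∑ i, ∑ j with i < j, (∫ u, χ u * χ (u - (X i - X j))) * Y (X i - X j) := by
    rw [integral_finsetSum _ (fun i _ => integrable_finsetSum _ fun j _ => hppint i j)]
    refine Finset.sum_congr rfl fun i _ => ?_
    rw [integral_finsetSum _ (fun j _ => hppint i j)]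
    exact Finset.sum_congr rfl fun j _ => hslide i j
  have hpb := fun i => sliding_pb_identity hχ hsupp hYm hgm (X i) (hgY i)
  have hpbI : Integrable fun z : Space => ∑ i, ∫ y, g y * (χ (X i - z) * Y (X i - y) * χ (y - z)) :=
    integrable_finsetSum _ fun i _ => (hpb i).1
  have hpbs : ∫ z : Space, ∑ i, ∫ y, g y * (χ (X i - z) * Y (X i - y) * χ (y - z)) =
      ∑ i, ∫ y, g y * ((∫ u, χ u * χ (u - (X i - y))) * Y (X i - y)) := by
    rw [integral_finsetSum _ (fun i _ => (hpb i).1)]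
    exact Finset.sum_congr rfl fun i _ => (hpb i).2
  obtain ⟨hbbI, hbb⟩ := sliding_bb_identity hχ hsupp hYm hgm hggY
  -- the `z`-integral of `U_z`
  have hUz : ∫ z : Space, ((∑ i, ∑ j with i < j, χ (X i - z) * Y (X i - X j) * χ (X j - z)) -
        (∑ i, ∫ y, g y * (χ (X i - z) * Y (X i - y) * χ (y - z))) +
        1 / 2 * ∫ q : Space × Space, g q.1 * g q.2 * (χ (q.1 - z) * Y (q.1 - q.2) * χ (q.2 - z))
          ∂(volume.prod volume)) =
      (∑ i, ∑ j with i < j, (∫ u, χ u * χ (u - (X i - X j))) * Y (X i - X j)) -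
        (∑ i, ∫ y, g y * ((∫ u, χ u * χ (u - (X i - y))) * Y (X i - y))) +
        1 / 2 * ∫ q : Space × Space, g q.1 * g q.2 * ((∫ u, χ u * χ (u - (q.1 - q.2))) * Y (q.1 - q.2))
          ∂(volume.prod volume) := by
    have hdiff : Integrable fun z : Space =>
        (∑ i, ∑ j with i < j, χ (X i - z) * Y (X i - X j) * χ (X j - z)) -
          (∑ i, ∫ y, g y * (χ (X i - z) * Y (X i - y) * χ (y - z))) := hppI.sub hpbI
    rw [integral_add hdiff (hbbI.const_mul _), integral_sub hppI hpbI, integral_const_mul,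
      hpp, hpbs, hbb]
  -- Step 3: split `|·|⁻¹ = F + hY` termwise
  have hFm : Measurable fun z : Space => ∫ p, Φ p * Real.cos (2 * π * ⟪p, z⟫_ℝ) :=
    measurable_cosKernel Φ hΦm
  have hHm : Measurable fun z : Space => ∫ u, χ u * χ (u - z) := measurable_autocorr χ hχ
  have hFb : ∀ z, ‖∫ p, Φ p * Real.cos (2 * π * ⟪p, z⟫_ℝ)‖ ≤ ∫ p, ‖Φ p‖ := norm_cosKernel_le hΦi
  have hHb : ∀ z, ‖∫ u, χ u * χ (u - z)‖ ≤ M * ∫ u, ‖χ u‖ := norm_autocorr_le hχint hM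
  have hmXi : ∀ i : Fin N, Measurable fun y : Space => X i - y := fun i =>
    measurable_const.sub measurable_id
  have hm12 : Measurable fun q : Space × Space => q.1 - q.2 := measurable_fst.sub measurable_snd
  have hFmi : ∀ i : Fin N, AEStronglyMeasurable
      (fun y : Space => ∫ p, Φ p * Real.cos (2 * π * ⟪p, X i - y⟫_ℝ)) volume := fun i =>
    (hFm.comp (hmXi i) : Measurable fun y : Space =>
      ∫ p, Φ p * Real.cos (2 * π * ⟪p, X i - y⟫_ℝ)).aestronglyMeasurable
  have hHmi : ∀ i : Fin N, AEStronglyMeasurable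
      (fun y : Space => ∫ u, χ u * χ (u - (X i - y))) volume := fun i =>
    (hHm.comp (hmXi i) : Measurable fun y : Space => ∫ u, χ u * χ (u - (X i - y))).aestronglyMeasurable
  have hFm2 : AEStronglyMeasurable
      (fun q : Space × Space => ∫ p, Φ p * Real.cos (2 * π * ⟪p, q.1 - q.2⟫_ℝ)) (volume.prod volume) :=
    (hFm.comp hm12 : Measurable fun q : Space × Space =>
      ∫ p, Φ p * Real.cos (2 * π * ⟪p, q.1 - q.2⟫_ℝ)).aestronglyMeasurable
  have hHm2 : AEStronglyMeasurable
      (fun q : Space × Space => ∫ u, χ u * χ (u - (q.1 - q.2))) (volume.prod volume) :=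
    (hHm.comp hm12 : Measurable fun q : Space × Space =>
      ∫ u, χ u * χ (u - (q.1 - q.2))).aestronglyMeasurable
  -- pp
  have dpp : ∑ i, ∑ j with i < j, ‖X i - X j‖⁻¹ =
      (∑ i, ∑ j with i < j, ∫ p, Φ p * Real.cos (2 * π * ⟪p, X i - X j⟫_ℝ)) +
        (∫ u, χ u ^ 2)⁻¹ *
          ∑ i, ∑ j with i < j, (∫ u, χ u * χ (u - (X i - X j))) * Y (X i - X j) := by
    rw [Finset.mul_sum, ← Finset.sum_add_distrib]
    refine Finset.sum_congr rfl fun i _ => ?_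
    rw [Finset.mul_sum, ← Finset.sum_add_distrib]
    refine Finset.sum_congr rfl fun j hj => ?_
    have hij : i < j := (Finset.mem_filter.1 hj).2
    rw [hF (X i - X j) (sub_ne_zero.2 (hX.ne hij.ne))]
    ring
  -- pb
  have dpb : ∀ i, ∫ y, g y * ‖X i - y‖⁻¹ =
      (∫ y, g y * ∫ p, Φ p * Real.cos (2 * π * ⟪p, X i - y⟫_ℝ)) +
        (∫ u, χ u ^ 2)⁻¹ * ∫ y, g y * ((∫ u, χ u * χ (u - (X i - y))) * Y (X i - y)) := by
    intro i
    have hI1 : Integrable fun y : Space => g y * ∫ p, Φ p * Real.cos (2 * π * ⟪p, X i - y⟫_ℝ) :=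
      hg.mul_bdd (c := ∫ p, ‖Φ p‖) (hFmi i) (Eventually.of_forall fun y => hFb _)
    have hI2 : Integrable fun y : Space => g y * ((∫ u, χ u * χ (u - (X i - y))) * Y (X i - y)) := by
      have h := (hgY i).bdd_mul (c := M * ∫ u, ‖χ u‖) (hHmi i) (Eventually.of_forall fun y => hHb _)
      refine h.congr (Eventually.of_forall fun y => ?_)
      simp only
      ring
    have hae : ∀ᵐ y : Space ∂volume, y ≠ X i := by
      have : (volume : Measure Space) {y | ¬y ≠ X i} = 0 := by
        simp only [ne_eq, not_not, setOf_eq_eq_singleton, measure_singleton]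
      exact ae_iff.2 this
    rw [← integral_const_mul, ← integral_add hI1 (hI2.const_mul _)]
    refine integral_congr_ae ?_
    filter_upwards [hae] with y hy
    rw [hF (X i - y) (sub_ne_zero.2 (Ne.symm hy))]
    ring
  have dpbs : ∑ i, ∫ y, g y * ‖X i - y‖⁻¹ =
      (∑ i, ∫ y, g y * ∫ p, Φ p * Real.cos (2 * π * ⟪p, X i - y⟫_ℝ)) +
        (∫ u, χ u ^ 2)⁻¹ * ∑ i, ∫ y, g y * ((∫ u, χ u * χ (u - (X i - y))) * Y (X i - y)) := by
    rw [Finset.mul_sum, ← Finset.sum_add_distrib]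
    exact Finset.sum_congr rfl fun i _ => dpb i
  -- bb
  have dbb : ∫ q : Space × Space, g q.1 * g q.2 * ‖q.1 - q.2‖⁻¹ ∂(volume.prod volume) =
      (∫ q : Space × Space, g q.1 * g q.2 * (∫ p, Φ p * Real.cos (2 * π * ⟪p, q.1 - q.2⟫_ℝ))
          ∂(volume.prod volume)) +
        (∫ u, χ u ^ 2)⁻¹ * ∫ q : Space × Space, g q.1 * g q.2 *
          ((∫ u, χ u * χ (u - (q.1 - q.2))) * Y (q.1 - q.2)) ∂(volume.prod volume) := by
    have hJ1 : Integrable (fun q : Space × Space => g q.1 * g q.2 *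
        (∫ p, Φ p * Real.cos (2 * π * ⟪p, q.1 - q.2⟫_ℝ))) (volume.prod volume) :=
      (hg.mul_prod hg).mul_bdd (c := ∫ p, ‖Φ p‖) hFm2 (Eventually.of_forall fun q => hFb _)
    have hJ2 : Integrable (fun q : Space × Space => g q.1 * g q.2 *
        ((∫ u, χ u * χ (u - (q.1 - q.2))) * Y (q.1 - q.2))) (volume.prod volume) := by
      have h := hggY.bdd_mul (c := M * ∫ u, ‖χ u‖) hHm2 (Eventually.of_forall fun q => hHb _)
      refine h.congr (Eventually.of_forall fun q => ?_)
      simp only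
      ring
    rw [← integral_const_mul, ← integral_add hJ1 (hJ2.const_mul _)]
    refine integral_congr_ae ?_
    filter_upwards [ae_fst_ne_snd] with q hq
    rw [hF (q.1 - q.2) (sub_ne_zero.2 hq)]
    ring
  -- Step 4: assemble
  rw [hUz, dpp, dpbs, dbb]
  linear_combination h0

end Literature.MathematicalPhysics.QuantumManyBody.Coulomb
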